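/-
Copyright (c) 2026 the pub-hodgecm-mathlib formalisation cell (harness21).  Prover seat hodgecm-mathlib-LH4-p07 (g2): Track A «(D-RAM) FOUR-FRAME» squad of crux H413
(dealer LH4-plan (g10) WORD #45 (2): children's HOME texts for the U2H ED. 7 cut of the (ρ) socket; follow-on (C2)-W of ★ p855475), 2026-09-03.
-/
import Literature.NumberTheory.Rogawski1990.FinExplicitTransferFactorLeviStratumOfFormCongr   -- ★ p855475 (this seat): HEAD `Δ‴ = μ_v(d₀)·‖a−1‖` on the Levi stratum, any non-split place
import Literature.NumberTheory.Rogawski1990.LeviNearOneTwoDeep                                -- ★ (O1″): `valued_sub_one_le_of_isRoot_charpoly_of_congr_one`, `isOpen_setOf_valued_le_valued`, `charpoly_map_endoEmbLocal_conj`, `continuous_endoEmbLocal`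
import HarnessLib

/-!
# The Levi-stratum value `Δ‴_v(yγ_Hy⁻¹, γ₀) = ‖d′₀⁻¹u − 1‖` as a GERM AT `1 ∈ H_v` in the CONJUGATE-DIAGONAL witness currency of the FOUR-FRAME rows, any non-split place
(Rogawski (1990) §4.9 p. 55, Prop. 4.9.1 (b); §3.1 p. 19)

Topic `NumberTheory/Rogawski1990`; namespace `Literature.NumberTheory.Rogawski1990`.  KERNEL mathematics only: theorems, no definition, no named fact, no instance, no notation,
no `sorry`.  Cell `pub/hodgecm-mathlib`, crux H413 = `stmt-HodgeConjecture-24833` (count-neutral), Track A «(D-RAM) FOUR-FRAME», unit U2H, ROW (3) (Levi) of the (ρ) socket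
`stub_U2H_rowsR_hFamily_unit0` — which quantifies `∀ γ_H ∈ V, … ∀ y d′, glDiagonal 2 d′ = (yγ_Hy⁻¹).1 → …`, i.e. over a CONJUGATE-DIAGONAL Levi witness, whereas ★ p855475 §5 and
★ L7 `UnitFundamentalLemmaLeviOfFormCongr` are stated at `γ_H` ITSELF diagonal.  The honest wild factor `τ_v = μ_v(d′₀)` of ★ p855475 must therefore be killed at the
EIGENVALUE `d′₀` of `γ_H.1`, which is not a continuous coordinate of `γ_H`; what is continuous is `ι_v(γ_H)`, and eigenvalues of a matrix `≡ 1 (mod c)` are `≡ 1 (mod c)`.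
HONEST LABEL: HC_CM is proved only modulo the 7 printed citations (2 remaining named inputs: hLiu418 = `stmt-HodgeConjecture-24832`, h413 = `stmt-HodgeConjecture-24833`)
until rung 0 closes; this file is unconditional, asserts nothing printed, freezes no stub text.

THE MATHEMATICS (`v` a finite place of `L⁺` NON-SPLIT in `L`, `w ∣ v`, any ramification).
* §1 **NEAR `1`, LEVI ⇒ `c`-DEEP, UNIFORMLY** (`c ≠ 0` in `L_w` arbitrary): `V_c := {γ_H | ι_v(γ_H)_w ≡ 1 (mod c) entrywise} ∈ 𝓝 1` (★ `continuous_endoEmbLocal`, closed balls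
  open), and for `γ_H ∈ V_c`, `ι_v(yγ_Hy⁻¹) = diag(d)`: `|d_{k,w} − 1|_w ≤ |c|_w` (★ `charpoly_map_endoEmbLocal_conj` + ★ (O1″) §1 `valued_sub_one_le_of_isRoot_charpoly_of_congr_one`,
  already `c`-general) — the depth-`c` twin of ★ (O1) `exists_nhds_one_forall_levi_deep` (1-deep) and ★ (O1″) `exists_nhds_one_forall_levi_twoDeep` (2-deep), proofs VERBATIM.
* §2 **`μ_v(d_k) = 1` NEAR `1`**: `μ_w ≡ 1` on `{|s − 1|_w ≤ |ϖ_v^{M₁}|_w}` (★ `exists_finHeckeValue_eq_one_of_valued_sub_one_le`) and §1 at `c = ι_wϖ_v^{M₁}`.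
* §3 HEAD **`exists_nhds_one_forall_finExplicitDelta_conj_eq_unitModulusChar_of_levi_of_formCongr`**: under the congruence binder `H′_w = ᵗσT·Φ₃·T` and the guard
  `μ|_{𝕀_{L⁺}} = ω`, there is `V ∈ 𝓝 (1 : H_v)` such that for all `γ_H ∈ V`, all `y, d′` with `(yγ_Hy⁻¹).1 = diag(d′)`, `yγ_Hy⁻¹ ∈ K_H`, `d′₀⁻¹u − 1`, `d′₀⁻¹d′₁ − 1`, `u − d′₁` units
  (`u = u(yγ_Hy⁻¹)`), and every `γ₀` matching `yγ_Hy⁻¹`: **`Δ‴_v(yγ_Hy⁻¹, γ₀) = ‖d′₀⁻¹u − 1‖`** — ★ p855475 HEAD at `yγ_Hy⁻¹` with `μ_v(d′₀) = 1` from §2; `Δ‴_v(γ_H, ·) = Δ‴_v(yγ_Hy⁻¹, ·)`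
  is ★ `finExplicitDelta_conj_left_all`.  + the `Φ₃`∕`T = 1` twin = the ED. 7 child text for ROW (3)'s transfer-factor input, payable BY NAME.

## References
* [Rogawski1990] J. D. Rogawski, *Automorphic Representations of Unitary Groups in Three Variables*, Ann. of Math. Stud. 123 (1990): §4.9 p. 55, Prop. 4.9.1 (b); §3.1 p. 19; §4.9 p. 54.
* [CasselsFrohlichANT1967] J. W. S. Cassels, A. Fröhlich (eds.), *Algebraic Number Theory* (1967), Ch. II §10.
* [BernsteinZelevinsky1976] I. N. Bernstein, A. V. Zelevinsky, *Representations of the group GL(n, F) where F is a non-archimedean local field*, §1.1.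
* [TateThesis1967] J. Tate, *Fourier analysis in number fields and Hecke's zeta-functions*, §2.3.
-/

set_option autoImplicit false

noncomputable section

open NumberField IsDedekindDomain Matrix Polynomial Topology Filter
open scoped NNReal Matrix MatrixGroups

namespace Literature.NumberTheory.Rogawski1990

open Literature.NumberTheory.Automorphic Literature.NumberTheory.Automorphic.UnitaryGroup
open Literature.NumberTheory.GaloisRepresentations

section CM

variable (L : Type) [Field L] [NumberField L] [IsCMField L] (v : HeightOneSpectrum (𝓞 ↥(maximalRealSubfield L))) (w : PlacesOver L v)

/-! ## §1 Near `1`, Levi ⇒ `c`-deep eigenvalues, uniformly (any `c ≠ 0`) -/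

set_option maxHeartbeats 1600000 in
set_option synthInstance.maxHeartbeats 400000 in
-- cold instance-term unification on the CM local carriers (VERBATIM budget of ★ `exists_nhds_one_twoDeep_endoEmbLocal`, same statement shape)
/-- **`ι_v(γ_H)_w ≡ 1 (mod c)` ENTRYWISE FOR ALL `γ_H` NEAR `1 ∈ H_v`** (`c ≠ 0` in `L_w`; the locus is open by continuity of `ι_v` — ★ `continuous_endoEmbLocal` — and of the
entries, closed balls being open ★ `isOpen_setOf_valued_le_valued`; it contains `1`).  The depth-`c` twin of ★ `exists_nhds_one_twoDeep_endoEmbLocal` (there `c = ϖ_w²`), proof VERBATIM.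
[cite: Rogawski1990, §4.9 p. 54] [cite: BernsteinZelevinsky1976, §1.1] -/
theorem exists_nhds_one_congrOne_endoEmbLocal {c : w.1.adicCompletion L} (hc : c ≠ 0) :
    ∃ V ∈ 𝓝 (1 : (cmDatum L 2 (Matrix.of fun i j : Fin 2 => if i.val + j.val + 1 = 2 then (1 : L) else 0)).Local v ×
        (cmDatum L 1 (Matrix.of fun i j : Fin 1 => if i.val + j.val + 1 = 1 then (1 : L) else 0)).Local v),
      ∀ γH ∈ V, ∀ a b : Fin 3, Valued.v ((((((endoEmbLocal L v γH).val : GL (Fin 3) (UnitaryGroup.LocalRing L v)) : Matrix (Fin 3) (Fin 3) (UnitaryGroup.LocalRing L v)).map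
        (Pi.evalRingHom (fun w' : PlacesOver L v => w'.1.adicCompletion L) w)) a b - (1 : Matrix (Fin 3) (Fin 3) (w.1.adicCompletion L)) a b)) ≤
          Valued.v c := by
  have hcont : Continuous fun γH : (cmDatum L 2 (Matrix.of fun i j : Fin 2 => if i.val + j.val + 1 = 2 then (1 : L) else 0)).Local v ×
        (cmDatum L 1 (Matrix.of fun i j : Fin 1 => if i.val + j.val + 1 = 1 then (1 : L) else 0)).Local v =>
      ((((endoEmbLocal L v γH).val : GL (Fin 3) (UnitaryGroup.LocalRing L v)) : Matrix (Fin 3) (Fin 3) (UnitaryGroup.LocalRing L v)).map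
        (Pi.evalRingHom (fun w' : PlacesOver L v => w'.1.adicCompletion L) w)) := by
    refine Continuous.matrix_map ?_ (continuous_apply w)
    exact Units.continuous_val.comp (continuous_subtype_val.comp (continuous_endoEmbLocal L v))
  -- the open locus `⋂_{a,b} {γ_H | |(ι_v(γ_H)_w − 1)_{ab}| ≤ |c|}` contains `1`
  have hopen : IsOpen (⋂ a : Fin 3, ⋂ b : Fin 3,
      (fun γH : (cmDatum L 2 (Matrix.of fun i j : Fin 2 => if i.val + j.val + 1 = 2 then (1 : L) else 0)).Local v ×
          (cmDatum L 1 (Matrix.of fun i j : Fin 1 => if i.val + j.val + 1 = 1 then (1 : L) else 0)).Local v =>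
        (((((endoEmbLocal L v γH).val : GL (Fin 3) (UnitaryGroup.LocalRing L v)) : Matrix (Fin 3) (Fin 3) (UnitaryGroup.LocalRing L v)).map
          (Pi.evalRingHom (fun w' : PlacesOver L v => w'.1.adicCompletion L) w)) a b - (1 : Matrix (Fin 3) (Fin 3) (w.1.adicCompletion L)) a b)) ⁻¹'
        {x : w.1.adicCompletion L | Valued.v x ≤ Valued.v c}) :=
    isOpen_iInter_of_finite fun a => isOpen_iInter_of_finite fun b =>
      (isOpen_setOf_valued_le_valued hc).preimage (((continuous_apply b).comp ((continuous_apply a).comp hcont)).sub continuous_const)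
  have h1 : ((1 : (cmDatum L 3 (Matrix.of fun i j : Fin 3 => if i.val + j.val + 1 = 3 then (1 : L) else 0)).Local v).val :
      GL (Fin 3) (UnitaryGroup.LocalRing L v)) = 1 := rfl
  have hmem : (1 : (cmDatum L 2 (Matrix.of fun i j : Fin 2 => if i.val + j.val + 1 = 2 then (1 : L) else 0)).Local v ×
        (cmDatum L 1 (Matrix.of fun i j : Fin 1 => if i.val + j.val + 1 = 1 then (1 : L) else 0)).Local v) ∈ ⋂ a : Fin 3, ⋂ b : Fin 3,
      (fun γH : (cmDatum L 2 (Matrix.of fun i j : Fin 2 => if i.val + j.val + 1 = 2 then (1 : L) else 0)).Local v ×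
          (cmDatum L 1 (Matrix.of fun i j : Fin 1 => if i.val + j.val + 1 = 1 then (1 : L) else 0)).Local v =>
        (((((endoEmbLocal L v γH).val : GL (Fin 3) (UnitaryGroup.LocalRing L v)) : Matrix (Fin 3) (Fin 3) (UnitaryGroup.LocalRing L v)).map
          (Pi.evalRingHom (fun w' : PlacesOver L v => w'.1.adicCompletion L) w)) a b - (1 : Matrix (Fin 3) (Fin 3) (w.1.adicCompletion L)) a b)) ⁻¹'
        {x : w.1.adicCompletion L | Valued.v x ≤ Valued.v c} := by
    simp only [Set.mem_iInter, Set.mem_preimage, Set.mem_setOf_eq]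
    intro a b
    rw [map_one, h1, Units.val_one, Matrix.map_one _ (map_zero _) (map_one _), sub_self, map_zero]
    exact zero_le
  refine ⟨_, hopen.mem_nhds hmem, fun γH hγ a b => ?_⟩
  simp only [Set.mem_iInter, Set.mem_preimage, Set.mem_setOf_eq] at hγ
  exact hγ a b

/-- **`c`-DEEP + LEVI ⇒ `c`-DEEP EIGENVALUES (pointwise).**  If `ι_v(γ_H)_w ≡ 1 (mod c)` entrywise (`c ≠ 0`, the text of `exists_nhds_one_congrOne_endoEmbLocal`) and
`ι_v(yγ_Hy⁻¹) = diag(d)`, then `|d_{k,w} − 1|_w ≤ |c|_w` for every `k` (`χ` is conjugation invariant ★ `charpoly_map_endoEmbLocal_conj`; the `d_{k,w}` are its roots; ★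
`valued_sub_one_le_of_isRoot_charpoly_of_congr_one`). [cite: Rogawski1990, §3.1 p. 19; §4.9 p. 54] [cite: CasselsFrohlichANT1967, Ch. II §10] -/
theorem valued_sub_one_le_of_congrOne_of_endoEmbLocal_conj_eq {c : w.1.adicCompletion L} (hc : c ≠ 0)
    (γH y : (cmDatum L 2 (Matrix.of fun i j : Fin 2 => if i.val + j.val + 1 = 2 then (1 : L) else 0)).Local v ×
      (cmDatum L 1 (Matrix.of fun i j : Fin 1 => if i.val + j.val + 1 = 1 then (1 : L) else 0)).Local v)
    (hγV : ∀ a b : Fin 3, Valued.v ((((((endoEmbLocal L v γH).val : GL (Fin 3) (UnitaryGroup.LocalRing L v)) : Matrix (Fin 3) (Fin 3) (UnitaryGroup.LocalRing L v)).map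
        (Pi.evalRingHom (fun w' : PlacesOver L v => w'.1.adicCompletion L) w)) a b - (1 : Matrix (Fin 3) (Fin 3) (w.1.adicCompletion L)) a b)) ≤
          Valued.v c)
    {d : Fin 3 → (UnitaryGroup.LocalRing L v)ˣ}
    (hι : ((endoEmbLocal L v (y * γH * y⁻¹)).val : GL (Fin 3) (UnitaryGroup.LocalRing L v)) = glDiagonal 3 (UnitaryGroup.LocalRing L v) d) (k : Fin 3) :
    Valued.v ((((d k : (UnitaryGroup.LocalRing L v)ˣ) : UnitaryGroup.LocalRing L v) w) - 1) ≤ Valued.v c := by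
  refine valued_sub_one_le_of_isRoot_charpoly_of_congr_one _ hc hγV ?_
  -- `χ(ι_v(γ_H)_w) = χ(ι_v(yγ_Hy⁻¹)_w) = χ(diag(d_w)) = ∏ (X − d_{k,w})`
  have hch := charpoly_map_endoEmbLocal_conj L w y γH
  rw [hι, coe_glDiagonal, Matrix.diagonal_map (RingHom.map_zero (Pi.evalRingHom (fun w' : PlacesOver L v => w'.1.adicCompletion L) w)),
    Matrix.charpoly_diagonal] at hch
  rw [Polynomial.IsRoot.def, ← hch, Polynomial.eval_prod]
  exact Finset.prod_eq_zero (Finset.mem_univ k) (by rw [eval_sub, eval_X, eval_C]; exact sub_self _)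

/-- **NEAR `1`, LEVI ⇒ `c`-DEEP (the uniform neighbourhood; `c ≠ 0` arbitrary).**  There is `V ∈ 𝓝 (1 : H_v)` such that for every `γ_H ∈ V`, every `y ∈ H_v` and every `d`
with `ι_v(yγ_Hy⁻¹) = diag(d)`: `|d_{k,w} − 1|_w ≤ |c|_w` for all `k` — the depth-`c` twin of ★ `exists_nhds_one_forall_levi_deep` ∕ ★ `exists_nhds_one_forall_levi_twoDeep`.
[cite: Rogawski1990, §3.1 p. 19; §4.9 p. 54] [cite: BernsteinZelevinsky1976, §1.1] -/
theorem exists_nhds_one_forall_levi_valued_sub_one_le {c : w.1.adicCompletion L} (hc : c ≠ 0) :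
    ∃ V ∈ 𝓝 (1 : (cmDatum L 2 (Matrix.of fun i j : Fin 2 => if i.val + j.val + 1 = 2 then (1 : L) else 0)).Local v ×
        (cmDatum L 1 (Matrix.of fun i j : Fin 1 => if i.val + j.val + 1 = 1 then (1 : L) else 0)).Local v),
      ∀ γH ∈ V, ∀ y : (cmDatum L 2 (Matrix.of fun i j : Fin 2 => if i.val + j.val + 1 = 2 then (1 : L) else 0)).Local v ×
          (cmDatum L 1 (Matrix.of fun i j : Fin 1 => if i.val + j.val + 1 = 1 then (1 : L) else 0)).Local v,
        ∀ d : Fin 3 → (UnitaryGroup.LocalRing L v)ˣ,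
          ((endoEmbLocal L v (y * γH * y⁻¹)).val : GL (Fin 3) (UnitaryGroup.LocalRing L v)) = glDiagonal 3 (UnitaryGroup.LocalRing L v) d →
            ∀ k : Fin 3, Valued.v ((((d k : (UnitaryGroup.LocalRing L v)ˣ) : UnitaryGroup.LocalRing L v) w) - 1) ≤ Valued.v c :=
  let ⟨V, hV, hVd⟩ := exists_nhds_one_congrOne_endoEmbLocal L v w hc
  ⟨V, hV, fun γH hγV y _ hι k => valued_sub_one_le_of_congrOne_of_endoEmbLocal_conj_eq L v w hc γH y (hVd γH hγV) hι k⟩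

/-! ## §2 Near `1`, `μ_v` is trivial on the eigenvalues of a Levi class -/

/-- **`μ_v(d_k) = 1` FOR THE EIGENVALUES OF EVERY LEVI CLASS NEAR `1`** (non-split `v`, ANY Hecke character `μ` of `L` — ramified at `w` allowed, no guard): `μ_w ≡ 1` on a ball
`{|s − 1|_w ≤ |ϖ_v^{M₁}|_w}` (★ `exists_finHeckeValue_eq_one_of_valued_sub_one_le`), and §1 at `c = ι_wϖ_v^{M₁}`. [cite: TateThesis1967, §2.3] [cite: Rogawski1990, §4.9 p. 55] -/
theorem exists_nhds_one_forall_finHeckeValue_eq_one_of_levi (hw : IsCMField.complexConj L • w.1 = w.1) (μ : HeckeCharacter L) :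
    ∃ V ∈ 𝓝 (1 : (cmDatum L 2 (Matrix.of fun i j : Fin 2 => if i.val + j.val + 1 = 2 then (1 : L) else 0)).Local v ×
        (cmDatum L 1 (Matrix.of fun i j : Fin 1 => if i.val + j.val + 1 = 1 then (1 : L) else 0)).Local v),
      ∀ γH ∈ V, ∀ y : (cmDatum L 2 (Matrix.of fun i j : Fin 2 => if i.val + j.val + 1 = 2 then (1 : L) else 0)).Local v ×
          (cmDatum L 1 (Matrix.of fun i j : Fin 1 => if i.val + j.val + 1 = 1 then (1 : L) else 0)).Local v,
        ∀ d : Fin 3 → (UnitaryGroup.LocalRing L v)ˣ,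
          ((endoEmbLocal L v (y * γH * y⁻¹)).val : GL (Fin 3) (UnitaryGroup.LocalRing L v)) = glDiagonal 3 (UnitaryGroup.LocalRing L v) d →
            ∀ k : Fin 3, finHeckeValue L v μ ((d k : (UnitaryGroup.LocalRing L v)ˣ) : UnitaryGroup.LocalRing L v) = 1 := by
  haveI : Algebra.IsQuadraticExtension ↥(maximalRealSubfield L) L := IsCMField.isQuadraticExtension L
  obtain ⟨M₁, -, hM₁⟩ := exists_finHeckeValue_eq_one_of_valued_sub_one_le L v w hw μ
  have hϖ0 : (toPlace v w (HeckeCharacter.uniformizer ↥(maximalRealSubfield L) v : v.adicCompletion ↥(maximalRealSubfield L))) ^ M₁ ≠ 0 := by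
    refine pow_ne_zero _ ?_
    rw [_root_.map_ne_zero]
    exact_mod_cast (HeckeCharacter.uniformizer ↥(maximalRealSubfield L) v).ne_zero
  obtain ⟨V, hV, h⟩ := exists_nhds_one_forall_levi_valued_sub_one_le L v w hϖ0
  exact ⟨V, hV, fun γH hγ y d hι k => hM₁ _ ((Pi.isUnit_iff.1 (d k).isUnit w).ne_zero) (h γH hγ y d hι k)⟩

end CM

/-! ## §3 HEAD: the Levi value as a germ at `1 ∈ H_v`, in the conjugate-diagonal witness currency -/

/-- **THE GERM OF THE LEVI VALUE IN THE FOUR-FRAME ROWS' WITNESS CURRENCY.**  Non-split `v`, ANY ramification, `H′_w = ᵗσT·Φ₃·T` (`hJT`), guard `μ|_{𝕀_{L⁺}} = ω`: there is a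
neighbourhood `V ∋ 1` of `H_v` such that for every `γ_H ∈ V`, every conjugate-diagonal Levi witness `y, d′` (`(yγ_Hy⁻¹).1 = diag(d′₀, d′₁)`) with `yγ_Hy⁻¹ ∈ K_H` and
`d′₀⁻¹u − 1`, `d′₀⁻¹d′₁ − 1`, `u − d′₁` units (`u = u(yγ_Hy⁻¹)`; ★ L7's `hd′ hγH ha hb h12` at `yγ_Hy⁻¹`), and every `γ₀ ∈ U(H′)(L⁺_v)` matching `yγ_Hy⁻¹`:
**`Δ‴_v(yγ_Hy⁻¹, γ₀) = ‖d′₀⁻¹u − 1‖`** — ★ p855475 HEAD `Δ‴ = μ_v(d′₀)·‖a − 1‖` at `yγ_Hy⁻¹`, with `μ_v(d′₀) = 1` because `d′₀` is an eigenvalue of a matrix near `1` (§2).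
(`Δ‴_v(γ_H, ·) = Δ‴_v(yγ_Hy⁻¹, ·)` is ★ `finExplicitDelta_conj_left_all`.) [cite: Rogawski1990, §4.9 p. 55, Prop. 4.9.1 (b); §3.1 p. 19] [cite: TateThesis1967, §2.3] -/
theorem exists_nhds_one_forall_finExplicitDelta_conj_eq_unitModulusChar_of_levi_of_formCongr (L : Type) [Field L] [NumberField L] [IsCMField L]
    (H' : Matrix (Fin 3) (Fin 3) L) (hH' : (H'.map (IsCMField.complexConj L))ᵀ = H') (hH'd : IsUnit H'.det)
    {v : HeightOneSpectrum (𝓞 ↥(maximalRealSubfield L))} (w : PlacesOver L v) (hw : IsCMField.complexConj L • w.1 = w.1)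
    (hJT : ∃ T : GL (Fin 3) (w.1.adicCompletion L), T ∈ glInt 3 (w.1.adicCompletion L) ∧
      placeForm H' w.1 = formCongr (galAdicCompletionMap (L := L) (IsCMField.complexConj L) hw) T ((StdForm.antidiagonal 3).over (w.1.adicCompletion L)))
    (μ : HeckeCharacter L)
    (hμω : ∀ x : ideleGroup ↥(maximalRealSubfield L), μ (AdeleRing.ideleBaseChange ↥(maximalRealSubfield L) L x) = quadraticHeckeCharCM L x) :
    ∃ V ∈ 𝓝 (1 : (cmDatum L 2 (Matrix.of fun i j : Fin 2 => if i.val + j.val + 1 = 2 then (1 : L) else 0)).Local v ×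
        (cmDatum L 1 (Matrix.of fun i j : Fin 1 => if i.val + j.val + 1 = 1 then (1 : L) else 0)).Local v),
      ∀ γH ∈ V, ∀ (y : (cmDatum L 2 (Matrix.of fun i j : Fin 2 => if i.val + j.val + 1 = 2 then (1 : L) else 0)).Local v ×
          (cmDatum L 1 (Matrix.of fun i j : Fin 1 => if i.val + j.val + 1 = 1 then (1 : L) else 0)).Local v) (d' : Fin 2 → (UnitaryGroup.LocalRing L v)ˣ),
        glDiagonal 2 (UnitaryGroup.LocalRing L v) d' = ((y * γH * y⁻¹).1.val : GL (Fin 2) (UnitaryGroup.LocalRing L v)) →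
        y * γH * y⁻¹ ∈ ((cmLocalIntegralLevel L 2 (Matrix.of fun i j : Fin 2 => if i.val + j.val + 1 = 2 then (1 : L) else 0) v).prod
          (cmLocalIntegralLevel L 1 (Matrix.of fun i j : Fin 1 => if i.val + j.val + 1 = 1 then (1 : L) else 0) v)) →
        ∀ (ha : IsUnit ((((d' 0)⁻¹ * (isUnit_finGammaTwo L v (y * γH * y⁻¹)).unit : (UnitaryGroup.LocalRing L v)ˣ) : UnitaryGroup.LocalRing L v) - 1)),
        IsUnit ((((d' 0)⁻¹ * d' 1 : (UnitaryGroup.LocalRing L v)ˣ) : UnitaryGroup.LocalRing L v) - 1) →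
        IsUnit (finGammaTwo L v (y * γH * y⁻¹) - (d' 1 : UnitaryGroup.LocalRing L v)) →
        ∀ γ₀ : (cmDatum L 3 H').Local v, IsLocalNormPair L H' v (y * γH * y⁻¹) γ₀ →
          finExplicitDelta L v H' (y * γH * y⁻¹) μ γ₀ = (((unitModulusChar (UnitaryGroup.LocalRing L v) ha.unit : ℝ≥0) : ℝ) : ℂ) := by
  classical
  obtain ⟨V, hV, hμ1⟩ := exists_nhds_one_forall_finHeckeValue_eq_one_of_levi L v w hw μ
  refine ⟨V, hV, fun γH hγ y d' hd' hγH' ha hb h12 γ₀ h₀ => ?_⟩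
  have hι := endoEmbLocal_eq_glDiagonal_of_fst_eq L v (y * γH * y⁻¹) hd'
  have hint := endoEmbLocal_mem_cmLocalIntegralLevel_of_nonsplit L w hw hγH'
  have hu : (((isUnit_finGammaTwo L v (y * γH * y⁻¹)).unit : (UnitaryGroup.LocalRing L v)ˣ) : UnitaryGroup.LocalRing L v) = finGammaTwo L v (y * γH * y⁻¹) :=
    (isUnit_finGammaTwo L v (y * γH * y⁻¹)).unit_spec
  have hreg3 := isUnit_vecCons_sub_of_levi ha hb (by rw [hu]; exact h12)
  rw [finExplicitDelta_eq_finHeckeValue_mul_unitModulusChar_of_levi_of_formCongr L H' hH' hH'd w hw hJT μ hμω (y * γH * y⁻¹) hι hreg3 hint ha h₀]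
  have h0 : finHeckeValue L v μ ((d' 0 : (UnitaryGroup.LocalRing L v)ˣ) : UnitaryGroup.LocalRing L v) = 1 := hμ1 γH hγ y _ hι 0
  change finHeckeValue L v μ ((d' 0 : (UnitaryGroup.LocalRing L v)ˣ) : UnitaryGroup.LocalRing L v) * _ = _
  rw [h0, one_mul]
  rfl

/-- **THE GERM FOR `U(Φ₃) = U(2,1)` (`H′ = Φ₃`, `T = 1`) AT ANY NON-SPLIT PLACE** — ROW (3)'s transfer-factor input of the FOUR-FRAME (ρ) socket, in its own witness currency
(`∀ γ_H ∈ V, ∀ y d′, glDiagonal 2 d′ = (yγ_Hy⁻¹).1 → …`): **`Δ‴_v(yγ_Hy⁻¹, γ₀) = ‖d′₀⁻¹u − 1‖`** for every matching `γ₀ ∈ U(Φ₃)(L⁺_v)`.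
[cite: Rogawski1990, §4.9 p. 55, Prop. 4.9.1 (b); §3.1 p. 19] -/
theorem exists_nhds_one_forall_finExplicitDelta_conj_eq_unitModulusChar_of_levi_antidiagOne (L : Type) [Field L] [NumberField L] [IsCMField L]
    {v : HeightOneSpectrum (𝓞 ↥(maximalRealSubfield L))} (w : PlacesOver L v) (hw : IsCMField.complexConj L • w.1 = w.1)
    (μ : HeckeCharacter L)
    (hμω : ∀ x : ideleGroup ↥(maximalRealSubfield L), μ (AdeleRing.ideleBaseChange ↥(maximalRealSubfield L) L x) = quadraticHeckeCharCM L x) :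
    ∃ V ∈ 𝓝 (1 : (cmDatum L 2 (Matrix.of fun i j : Fin 2 => if i.val + j.val + 1 = 2 then (1 : L) else 0)).Local v ×
        (cmDatum L 1 (Matrix.of fun i j : Fin 1 => if i.val + j.val + 1 = 1 then (1 : L) else 0)).Local v),
      ∀ γH ∈ V, ∀ (y : (cmDatum L 2 (Matrix.of fun i j : Fin 2 => if i.val + j.val + 1 = 2 then (1 : L) else 0)).Local v ×
          (cmDatum L 1 (Matrix.of fun i j : Fin 1 => if i.val + j.val + 1 = 1 then (1 : L) else 0)).Local v) (d' : Fin 2 → (UnitaryGroup.LocalRing L v)ˣ),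
        glDiagonal 2 (UnitaryGroup.LocalRing L v) d' = ((y * γH * y⁻¹).1.val : GL (Fin 2) (UnitaryGroup.LocalRing L v)) →
        y * γH * y⁻¹ ∈ ((cmLocalIntegralLevel L 2 (Matrix.of fun i j : Fin 2 => if i.val + j.val + 1 = 2 then (1 : L) else 0) v).prod
          (cmLocalIntegralLevel L 1 (Matrix.of fun i j : Fin 1 => if i.val + j.val + 1 = 1 then (1 : L) else 0) v)) →
        ∀ (ha : IsUnit ((((d' 0)⁻¹ * (isUnit_finGammaTwo L v (y * γH * y⁻¹)).unit : (UnitaryGroup.LocalRing L v)ˣ) : UnitaryGroup.LocalRing L v) - 1)),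
        IsUnit ((((d' 0)⁻¹ * d' 1 : (UnitaryGroup.LocalRing L v)ˣ) : UnitaryGroup.LocalRing L v) - 1) →
        IsUnit (finGammaTwo L v (y * γH * y⁻¹) - (d' 1 : UnitaryGroup.LocalRing L v)) →
        ∀ γ₀ : (cmDatum L 3 (Matrix.of fun i j : Fin 3 => if i.val + j.val + 1 = 3 then (1 : L) else 0)).Local v,
          IsLocalNormPair L (Matrix.of fun i j : Fin 3 => if i.val + j.val + 1 = 3 then (1 : L) else 0) v (y * γH * y⁻¹) γ₀ →
          finExplicitDelta L v (Matrix.of fun i j : Fin 3 => if i.val + j.val + 1 = 3 then (1 : L) else 0) (y * γH * y⁻¹) μ γ₀ =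
            (((unitModulusChar (UnitaryGroup.LocalRing L v) ha.unit : ℝ≥0) : ℝ) : ℂ) :=
  exists_nhds_one_forall_finExplicitDelta_conj_eq_unitModulusChar_of_levi_of_formCongr L
    (Matrix.of fun i j : Fin 3 => if i.val + j.val + 1 = 3 then (1 : L) else 0)
    (antidiagOne_map_transpose (IsCMField.complexConj L) 3) (isUnit_antidiagOne_det L 3) w hw
    ⟨1, one_mem _, by rw [formCongr_one_eq, placeForm_antidiagOne]⟩ μ hμω

end Literature.NumberTheory.Rogawski1990

end
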